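import Summits.Ventures.HodgeRepro2.T5SU11ImproperHardyClass
import Summits.Ventures.HodgeRepro2.T5SU11HardyRemainderResolvent

/-!
# The Hardy identity with remainder on the class

Row 532 proved the Hardy inequality `‖G^I_λ g‖² ≤ ‖(G^I_λ g)′‖²` on the exponentially decaying class (every `λ > 1`,
source rate `ε > 1`). Here the ground-state identity of row 477 is carried to the class with its remainder:

**`hardy_identity_class`**: `‖(G^I_λ g)′‖² − ‖G^I_λ g‖² = ∫_{(0,∞)} sinh 2t ((G^I_λ g)′Ξ − (G^I_λ g)Ξ′)²/Ξ²`.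

The remainder integrand `r` is continuous on `(0, ∞)` (`continuousOn_remainder_class`), bounded near `0⁺`
(`eventually_abs_remainder_le`: `u`, `u′` bounded near `0` by rows 499 and 529, `Ξ ≥ e^{−1}/8` on `[0, 1]`), integrable on
`(0, ∞)` (`integrableOn_remainder_class`: on `(0, 1]` by the bound, on `(1, ∞)` because `r ≥ 0` and
`∫_1^R r = ∫_1^R sinh 2t u′² − ∫_1^R sinh 2t u² − (H(R) − H(1))` converges as `R → ∞` by rows 530 and 532), and the
identity on `[ε₀, R]` (`remainder_identity_interval_class`, row 477's `hardy_identity_inhom`) passes to both limits.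
The equality case and the strict inequalities are in `T5SU11ImproperHardyStrictClass`. Nothing is claimed about (N).

Blind lane: Mathlib + the HodgeRepro2 prefix only; no sorry; axioms ⊆ {propext, Classical.choice,
Quot.sound}.
-/

namespace Summit.Ventures.HodgeRepro2.T5SU11ImproperHardyRemainderClass

open Filter Topology MeasureTheory intervalIntegral
open Set (Ioi Ioc Icc Ioo uIcc)
open T5SU11Cartan T5SU11SphericalFunction T5SU11SphericalBounds T5SU11SphericalContinuous
  T5SU11SphericalSolutionSpaceAll T5SU11SphericalDecay T5SU11SphericalXiLog T5SU11ReductionOfOrder T5SU11RadialGreen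
  T5SU11RadialGreenImproper T5SU11RadialGreenImproperOrigin T5SU11RadialGreenImproperDecaySource
  T5SU11RadialGreenImproperStable T5SU11GroundStateTransform T5SU11HardyRemainderResolvent
  T5SU11ImproperDerivativeBoundsAll T5SU11ImproperEnergyBracketAll T5SU11ImproperEnergyIdentityAll
  T5SU11ImproperHardyClass

/-- A function continuous on `(0, ∞)` and bounded near `0⁺` is integrable on every `(0, R]`. -/
theorem integrableOn_Ioc_of_bounded {F : ℝ → ℝ} (hF : ContinuousOn F (Ioi 0))
    {B : ℝ} (hB : ∀ᶠ t in 𝓝[>] (0 : ℝ), |F t| ≤ B) (R : ℝ) : IntegrableOn F (Ioc 0 R) := by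
  obtain ⟨δ, hδ, hδB⟩ := mem_nhdsGT_iff_exists_Ioo_subset.mp hB
  have hδ0 : 0 < δ := hδ
  set δ' := δ / 2 with hδ'
  have hδ'0 : 0 < δ' := by positivity
  have hδ'δ : δ' < δ := by rw [hδ']; linarith
  have hsub : Ioc 0 R ⊆ Ioc 0 δ' ∪ Icc δ' R := by
    intro t ht
    rcases le_or_gt t δ' with h1 | h1
    · exact Or.inl ⟨ht.1, h1⟩
    · exact Or.inr ⟨h1.le, ht.2⟩
  have hI1 : IntegrableOn F (Ioc 0 δ') := by
    have hI : IntegrableOn (fun _ : ℝ => B) (Ioc 0 δ') :=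
      integrableOn_const (by rw [Real.volume_Ioc]; exact ENNReal.ofReal_ne_top)
    refine Integrable.mono' hI ((hF.mono (fun t ht => ht.1)).aestronglyMeasurable measurableSet_Ioc) ?_
    refine (ae_restrict_iff' measurableSet_Ioc).mpr (Eventually.of_forall fun t ht => ?_)
    rw [Real.norm_eq_abs]
    exact hδB ⟨ht.1, lt_of_le_of_lt ht.2 hδ'δ⟩
  have hI2 : IntegrableOn F (Icc δ' R) :=
    (hF.mono (fun t ht => lt_of_lt_of_le hδ'0 ht.1)).integrableOn_Icc
  exact (hI1.union hI2).mono_set hsub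

section measure

variable [MeasurableSpace Circle] [BorelSpace Circle]

variable {lam : ℝ} (hlam : 1 < lam) {g : ℝ → ℝ} (hg : ContinuousOn g (Ioi 0))
  {M : ℝ} (hM : ∀ s ∈ Ioc (0 : ℝ) 1, |g s| ≤ M) (hM0 : 0 ≤ M)
  {ε C s₀ : ℝ} (hε : 2 - lam < ε) (hC : ∀ s, s₀ ≤ s → |g s| ≤ C * Real.exp (-ε * s))
  (hε1 : 1 < ε)

/-! ### Derivative data of `u = G^I_λ g` on the class -/

include hlam hg hM hM0 hε hC in
/-- `u = G^I_λ g` has derivative `u′` on `(0, ∞)`. -/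
theorem hasDerivAt_greenSolI_class {t : ℝ} (ht : 0 < t) :
    HasDerivAt (greenSolI (fun t => sph lam (hyp t)) (sphDecay lam) g)
      (greenSolI' (deriv fun t => sph lam (hyp t)) (sphDecay' lam) (fun t => sph lam (hyp t)) (sphDecay lam) g t) t :=
  hasDerivAt_greenSolI (hφ_sph lam) (fun _ hs => hasDerivAt_sphDecay hlam hs) hg
    (integrableOn_sph_mul_mul_sinh_Ioc hg hM hM0 lam) (integrableOn_sphDecay_mul_mul_sinh hlam hg hM hM0 hε hC) ht

include hlam hg hM hM0 hε hC in
/-- `u′` has derivative `u″` on `(0, ∞)`. -/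
theorem hasDerivAt_greenSolI'_class {t : ℝ} (ht : 0 < t) :
    HasDerivAt (greenSolI' (deriv fun t => sph lam (hyp t)) (sphDecay' lam) (fun t => sph lam (hyp t)) (sphDecay lam) g)
      (greenSolI'' (deriv (deriv fun t => sph lam (hyp t))) (sphDecay'' lam) (deriv fun t => sph lam (hyp t))
        (sphDecay' lam) (fun t => sph lam (hyp t)) (sphDecay lam) g t) t :=
  hasDerivAt_greenSolI' (hφ_sph lam) (hφ'_sph lam) (fun _ hs => hasDerivAt_sphDecay hlam hs)
    (fun _ hs => hasDerivAt_sphDecay' lam hs) hg (integrableOn_sph_mul_mul_sinh_Ioc hg hM hM0 lam)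
    (integrableOn_sphDecay_mul_mul_sinh hlam hg hM hM0 hε hC) ht

include hlam hg hM hM0 hε hC in
/-- `u′` is continuous on `(0, ∞)`. -/
theorem continuousOn_greenSolI'_class :
    ContinuousOn (greenSolI' (deriv fun t => sph lam (hyp t)) (sphDecay' lam) (fun t => sph lam (hyp t))
      (sphDecay lam) g) (Ioi 0) :=
  fun _ ht => (hasDerivAt_greenSolI'_class hlam hg hM hM0 hε hC ht).continuousAt.continuousWithinAt

/-! ### The remainder integrand `r = sinh 2t (u′Ξ − uΞ′)²/Ξ²` -/

include hlam hg hM hM0 hε hC in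
/-- The remainder integrand of `u = G^I_λ g` is continuous on `(0, ∞)`. -/
theorem continuousOn_remainder_class :
    ContinuousOn (fun t => Real.sinh (2 * t) * (greenSolI' (deriv fun t => sph lam (hyp t)) (sphDecay' lam)
        (fun t => sph lam (hyp t)) (sphDecay lam) g t * sph 1 (hyp t)
      - greenSolI (fun t => sph lam (hyp t)) (sphDecay lam) g t * deriv (fun t => sph 1 (hyp t)) t) ^ 2
        / sph 1 (hyp t) ^ 2) (Ioi 0) := by
  have hcu : ContinuousOn (greenSolI (fun t => sph lam (hyp t)) (sphDecay lam) g) (Ioi 0) :=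
    continuousOn_greenSolI hlam hg hM hM0 hε hC
  have hcu' := continuousOn_greenSolI'_class hlam hg hM hM0 hε hC
  have hcs : ContinuousOn (fun t => Real.sinh (2 * t)) (Ioi 0) :=
    (Real.continuous_sinh.comp (continuous_const.mul continuous_id)).continuousOn
  have hΞ : Continuous fun t => sph 1 (hyp t) := continuous_sph_hyp 1
  have hΞ' : Continuous (deriv fun t => sph 1 (hyp t)) :=
    continuous_iff_continuousAt.mpr fun t => (hasDerivAt_deriv_sph_hyp 1 t).continuousAt
  refine (hcs.mul (((hcu'.mul hΞ.continuousOn).sub (hcu.mul hΞ'.continuousOn)).pow 2)).div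
    (hΞ.continuousOn.pow 2) (fun t _ => ?_)
  exact pow_ne_zero 2 (sph_hyp_pos 1 t).ne'

include hlam hg hM hM0 hε hC in
/-- The remainder integrand of `u = G^I_λ g` is bounded near `0⁺`. -/
theorem eventually_abs_remainder_le :
    ∃ B : ℝ, ∀ᶠ t in 𝓝[>] (0 : ℝ), |Real.sinh (2 * t) * (greenSolI' (deriv fun t => sph lam (hyp t)) (sphDecay' lam)
        (fun t => sph lam (hyp t)) (sphDecay lam) g t * sph 1 (hyp t)
      - greenSolI (fun t => sph lam (hyp t)) (sphDecay lam) g t * deriv (fun t => sph 1 (hyp t)) t) ^ 2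
        / sph 1 (hyp t) ^ 2| ≤ B := by
  obtain ⟨Bu, hBu⟩ := eventually_abs_greenSolI_le hlam hM hM0 (integrableOn_sphDecay_mul_mul_sinh hlam hg hM hM0 hε hC)
  obtain ⟨Bu', hBu'⟩ := eventually_abs_greenSolI'_le_all hlam hg hM hM0 hε hC
  have hΞ : Continuous fun t => sph 1 (hyp t) := continuous_sph_hyp 1
  have hΞ' : Continuous (deriv fun t => sph 1 (hyp t)) :=
    continuous_iff_continuousAt.mpr fun t => (hasDerivAt_deriv_sph_hyp 1 t).continuousAt
  obtain ⟨BΞ, hBΞ⟩ := isCompact_Icc.exists_bound_of_continuousOn (s := Icc (0 : ℝ) 1) hΞ.continuousOn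
  obtain ⟨BΞ', hBΞ'⟩ := isCompact_Icc.exists_bound_of_continuousOn (s := Icc (0 : ℝ) 1) hΞ'.continuousOn
  refine ⟨Real.sinh 2 * (|Bu'| * BΞ + |Bu| * BΞ') ^ 2 / (Real.exp (-1) / 8) ^ 2, ?_⟩
  filter_upwards [hBu, hBu', Ioo_mem_nhdsGT one_pos] with t hBt hB't ht
  have hsinh : 0 ≤ Real.sinh (2 * t) := Real.sinh_nonneg_iff.mpr (by linarith [ht.1])
  have hs : Real.sinh (2 * t) ≤ Real.sinh 2 := Real.sinh_le_sinh.mpr (by linarith [ht.2])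
  have hΞpos : 0 < sph 1 (hyp t) := sph_hyp_pos 1 t
  have hc : Real.exp (-1) / 8 ≤ sph 1 (hyp t) := by
    refine le_trans ?_ (le_sph_one_hyp ht.1.le)
    have h1 : Real.exp (-1) ≤ Real.exp (-t) := Real.exp_le_exp.mpr (by linarith [ht.2])
    have h2 : (1 : ℝ) ≤ 1 + t := by linarith [ht.1]
    calc Real.exp (-1) / 8 = 1 / 8 * 1 * Real.exp (-1) := by ring
      _ ≤ 1 / 8 * (1 + t) * Real.exp (-t) :=
          mul_le_mul (mul_le_mul_of_nonneg_left h2 (by norm_num)) h1 (Real.exp_pos _).le (by positivity)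
  have hΞt : |sph 1 (hyp t)| ≤ BΞ := by
    have := hBΞ t ⟨ht.1.le, ht.2.le⟩
    rwa [Real.norm_eq_abs] at this
  have hΞ't : |deriv (fun t => sph 1 (hyp t)) t| ≤ BΞ' := by
    have := hBΞ' t ⟨ht.1.le, ht.2.le⟩
    rwa [Real.norm_eq_abs] at this
  have hnum : |greenSolI' (deriv fun t => sph lam (hyp t)) (sphDecay' lam) (fun t => sph lam (hyp t)) (sphDecay lam) g t
      * sph 1 (hyp t) - greenSolI (fun t => sph lam (hyp t)) (sphDecay lam) g t * deriv (fun t => sph 1 (hyp t)) t|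
      ≤ |Bu'| * BΞ + |Bu| * BΞ' := by
    calc _ ≤ |greenSolI' (deriv fun t => sph lam (hyp t)) (sphDecay' lam) (fun t => sph lam (hyp t)) (sphDecay lam) g t
          * sph 1 (hyp t)| + |greenSolI (fun t => sph lam (hyp t)) (sphDecay lam) g t * deriv (fun t => sph 1 (hyp t)) t| :=
          abs_sub _ _
      _ = |greenSolI' (deriv fun t => sph lam (hyp t)) (sphDecay' lam) (fun t => sph lam (hyp t)) (sphDecay lam) g t|
          * |sph 1 (hyp t)| + |greenSolI (fun t => sph lam (hyp t)) (sphDecay lam) g t|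
          * |deriv (fun t => sph 1 (hyp t)) t| := by rw [abs_mul, abs_mul]
      _ ≤ |Bu'| * BΞ + |Bu| * BΞ' :=
          add_le_add (mul_le_mul (le_trans hB't (le_abs_self _)) hΞt (abs_nonneg _) (abs_nonneg _))
            (mul_le_mul (le_trans hBt (le_abs_self _)) hΞ't (abs_nonneg _) (abs_nonneg _))
  calc |Real.sinh (2 * t) * (greenSolI' (deriv fun t => sph lam (hyp t)) (sphDecay' lam)
        (fun t => sph lam (hyp t)) (sphDecay lam) g t * sph 1 (hyp t)
      - greenSolI (fun t => sph lam (hyp t)) (sphDecay lam) g t * deriv (fun t => sph 1 (hyp t)) t) ^ 2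
        / sph 1 (hyp t) ^ 2|
      = Real.sinh (2 * t) * |greenSolI' (deriv fun t => sph lam (hyp t)) (sphDecay' lam)
        (fun t => sph lam (hyp t)) (sphDecay lam) g t * sph 1 (hyp t)
      - greenSolI (fun t => sph lam (hyp t)) (sphDecay lam) g t * deriv (fun t => sph 1 (hyp t)) t| ^ 2
        / sph 1 (hyp t) ^ 2 := by
        rw [abs_div, abs_mul, abs_of_nonneg hsinh, abs_pow, abs_pow, abs_of_pos hΞpos]
    _ ≤ Real.sinh 2 * (|Bu'| * BΞ + |Bu| * BΞ') ^ 2 / (Real.exp (-1) / 8) ^ 2 :=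
        div_le_div₀ (by positivity)
          (mul_le_mul hs (pow_le_pow_left₀ (abs_nonneg _) hnum 2) (by positivity) (Real.sinh_pos_iff.mpr two_pos).le)
          (by positivity) (pow_le_pow_left₀ (by positivity) hc 2)

include hlam hg hM hM0 hε hC in
/-- **`∫_{ε₀}^R r = ∫_{ε₀}^R sinh 2t u′² − ∫_{ε₀}^R sinh 2t u² − (H(R) − H(ε₀))`** for `u = G^I_λ g` (row 477's identity). -/
theorem remainder_identity_interval_class {ε₀ R : ℝ} (hε₀ : 0 < ε₀) (hεR : ε₀ ≤ R) :
    ∫ t in ε₀..R, Real.sinh (2 * t) * (greenSolI' (deriv fun t => sph lam (hyp t)) (sphDecay' lam)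
        (fun t => sph lam (hyp t)) (sphDecay lam) g t * sph 1 (hyp t)
      - greenSolI (fun t => sph lam (hyp t)) (sphDecay lam) g t * deriv (fun t => sph 1 (hyp t)) t) ^ 2
        / sph 1 (hyp t) ^ 2
      = (∫ t in ε₀..R, Real.sinh (2 * t) * greenSolI' (deriv fun t => sph lam (hyp t)) (sphDecay' lam)
          (fun t => sph lam (hyp t)) (sphDecay lam) g t ^ 2)
        - (∫ t in ε₀..R, Real.sinh (2 * t) * greenSolI (fun t => sph lam (hyp t)) (sphDecay lam) g t ^ 2)
        - (hardyBracket (greenSolI (fun t => sph lam (hyp t)) (sphDecay lam) g) R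
          - hardyBracket (greenSolI (fun t => sph lam (hyp t)) (sphDecay lam) g) ε₀) := by
  have hR : 0 < R := lt_of_lt_of_le hε₀ hεR
  have hsub : uIcc ε₀ R ⊆ Ioi 0 := uIcc_subset_Ioi hε₀ hR
  have hcu : ContinuousOn (greenSolI (fun t => sph lam (hyp t)) (sphDecay lam) g) (Ioi 0) :=
    continuousOn_greenSolI hlam hg hM hM0 hε hC
  have hcu' := continuousOn_greenSolI'_class hlam hg hM hM0 hε hC
  have hcs : ContinuousOn (fun t => Real.sinh (2 * t)) (Ioi 0) :=
    (Real.continuous_sinh.comp (continuous_const.mul continuous_id)).continuousOn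
  have hA : IntervalIntegrable (fun t => Real.sinh (2 * t) * greenSolI' (deriv fun t => sph lam (hyp t)) (sphDecay' lam)
      (fun t => sph lam (hyp t)) (sphDecay lam) g t ^ 2) volume ε₀ R :=
    ((hcs.mul (hcu'.pow 2)).mono hsub).intervalIntegrable
  have hB : IntervalIntegrable (fun t => Real.sinh (2 * t) * greenSolI (fun t => sph lam (hyp t)) (sphDecay lam) g t ^ 2)
      volume ε₀ R :=
    ((hcs.mul (hcu.pow 2)).mono hsub).intervalIntegrable
  have hQ : IntervalIntegrable (fun t => Real.sinh (2 * t) * (greenSolI' (deriv fun t => sph lam (hyp t)) (sphDecay' lam)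
        (fun t => sph lam (hyp t)) (sphDecay lam) g t * sph 1 (hyp t)
      - greenSolI (fun t => sph lam (hyp t)) (sphDecay lam) g t * deriv (fun t => sph 1 (hyp t)) t) ^ 2
        / sph 1 (hyp t) ^ 2) volume ε₀ R :=
    ((continuousOn_remainder_class hlam hg hM hM0 hε hC).mono hsub).intervalIntegrable
  have h := hardy_identity_inhom (fun t ht => hasDerivAt_greenSolI_class hlam hg hM hM0 hε hC ht) hcu' hε₀ hεR
  rw [integral_sub (hA.sub hB) hQ, integral_sub hA hB] at h
  linarith

include hlam hg hM hM0 hε hC hε1 in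
/-- **The remainder integrand of `u = G^I_λ g` is integrable on `(0, ∞)`**: on `(0, 1]` by the bound near `0⁺`, on
`(1, ∞)` because `r ≥ 0` and `∫_1^R r` converges as `R → ∞` (rows 530 and 532). -/
theorem integrableOn_remainder_class :
    IntegrableOn (fun t => Real.sinh (2 * t) * (greenSolI' (deriv fun t => sph lam (hyp t)) (sphDecay' lam)
        (fun t => sph lam (hyp t)) (sphDecay lam) g t * sph 1 (hyp t)
      - greenSolI (fun t => sph lam (hyp t)) (sphDecay lam) g t * deriv (fun t => sph 1 (hyp t)) t) ^ 2
        / sph 1 (hyp t) ^ 2) (Ioi 0) := by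
  set u := greenSolI (fun t => sph lam (hyp t)) (sphDecay lam) g with hu_def
  set u' := greenSolI' (deriv fun t => sph lam (hyp t)) (sphDecay' lam) (fun t => sph lam (hyp t)) (sphDecay lam) g
    with hu'_def
  set r : ℝ → ℝ := fun t => Real.sinh (2 * t) * (u' t * sph 1 (hyp t) - u t * deriv (fun t => sph 1 (hyp t)) t) ^ 2
    / sph 1 (hyp t) ^ 2 with hr_def
  have hrc := continuousOn_remainder_class hlam hg hM hM0 hε hC
  obtain ⟨B, hB⟩ := eventually_abs_remainder_le hlam hg hM hM0 hε hC
  have hIoc : ∀ R, IntegrableOn r (Ioc 0 R) := fun R => integrableOn_Ioc_of_bounded hrc hB R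
  have hI1 := integrableOn_sinh_mul_greenSolI_sq hlam hg hM hM0 hε hC hε1
  have hI2 := integrableOn_sinh_mul_greenSolI'_sq hlam hg hM hM0 hε hC hε1
  have hIoi : IntegrableOn r (Ioi 1) := by
    refine integrableOn_Ioi_of_intervalIntegral_norm_tendsto
      ((∫ t in Ioi 1, Real.sinh (2 * t) * u' t ^ 2) - (∫ t in Ioi 1, Real.sinh (2 * t) * u t ^ 2)
        - (0 - hardyBracket u 1)) 1
      (fun R => (hIoc R).mono_set (Set.Ioc_subset_Ioc_left zero_le_one)) tendsto_id ?_
    have hlim : Tendsto (fun R => (∫ t in (1 : ℝ)..R, Real.sinh (2 * t) * u' t ^ 2)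
        - (∫ t in (1 : ℝ)..R, Real.sinh (2 * t) * u t ^ 2) - (hardyBracket u R - hardyBracket u 1)) atTop
        (𝓝 ((∫ t in Ioi 1, Real.sinh (2 * t) * u' t ^ 2) - (∫ t in Ioi 1, Real.sinh (2 * t) * u t ^ 2)
          - (0 - hardyBracket u 1))) :=
      ((intervalIntegral_tendsto_integral_Ioi 1 (hI2.mono_set (Set.Ioi_subset_Ioi zero_le_one)) tendsto_id).sub
        (intervalIntegral_tendsto_integral_Ioi 1 (hI1.mono_set (Set.Ioi_subset_Ioi zero_le_one)) tendsto_id)).sub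
        ((tendsto_hardyBracket_greenSolI_atTop hlam hg hM hM0 hε hC hε1).sub tendsto_const_nhds)
    refine hlim.congr' ?_
    filter_upwards [eventually_ge_atTop 1] with R hR
    have hnorm : ∫ t in (1 : ℝ)..R, ‖r t‖ = ∫ t in (1 : ℝ)..R, r t := by
      apply intervalIntegral.integral_congr
      intro t ht
      rw [Set.uIcc_of_le hR] at ht
      show ‖r t‖ = r t
      rw [Real.norm_eq_abs]
      exact abs_of_nonneg (remainder_nonneg u u' (by linarith [ht.1]))
    rw [hnorm]
    exact (remainder_identity_interval_class hlam hg hM hM0 hε hC one_pos hR).symm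
  have := (hIoc 1).union hIoi
  rwa [Set.Ioc_union_Ioi_eq_Ioi zero_le_one] at this

include hlam hg hM hM0 hε hC hε1 in
/-- **THE HARDY IDENTITY WITH REMAINDER ON THE CLASS**:
`∫_{(0,∞)} sinh 2t (u′Ξ − uΞ′)²/Ξ² = ∫_{(0,∞)} sinh 2t u′² − ∫_{(0,∞)} sinh 2t u²` for `u = G^I_λ g`, every `λ > 1`, source
rate `ε > 1`. -/
theorem hardy_identity_class :
    ∫ t in Ioi 0, Real.sinh (2 * t) * (greenSolI' (deriv fun t => sph lam (hyp t)) (sphDecay' lam)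
        (fun t => sph lam (hyp t)) (sphDecay lam) g t * sph 1 (hyp t)
      - greenSolI (fun t => sph lam (hyp t)) (sphDecay lam) g t * deriv (fun t => sph 1 (hyp t)) t) ^ 2
        / sph 1 (hyp t) ^ 2
      = (∫ t in Ioi 0, Real.sinh (2 * t) * greenSolI' (deriv fun t => sph lam (hyp t)) (sphDecay' lam)
          (fun t => sph lam (hyp t)) (sphDecay lam) g t ^ 2)
        - ∫ t in Ioi 0, Real.sinh (2 * t) * greenSolI (fun t => sph lam (hyp t)) (sphDecay lam) g t ^ 2 := by
  set u := greenSolI (fun t => sph lam (hyp t)) (sphDecay lam) g with hu_def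
  set u' := greenSolI' (deriv fun t => sph lam (hyp t)) (sphDecay' lam) (fun t => sph lam (hyp t)) (sphDecay lam) g
    with hu'_def
  set r : ℝ → ℝ := fun t => Real.sinh (2 * t) * (u' t * sph 1 (hyp t) - u t * deriv (fun t => sph 1 (hyp t)) t) ^ 2
    / sph 1 (hyp t) ^ 2 with hr_def
  have hrc := continuousOn_remainder_class hlam hg hM hM0 hε hC
  obtain ⟨B, hB⟩ := eventually_abs_remainder_le hlam hg hM hM0 hε hC
  have hIoc : ∀ R, IntegrableOn r (Ioc 0 R) := fun R => integrableOn_Ioc_of_bounded hrc hB R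
  have hIr := integrableOn_remainder_class hlam hg hM hM0 hε hC hε1
  have hI1 := integrableOn_sinh_mul_greenSolI_sq hlam hg hM hM0 hε hC hε1
  have hI2 := integrableOn_sinh_mul_greenSolI'_sq hlam hg hM hM0 hε hC hε1
  have hA := integrableOn_sphDecay_mul_mul_sinh hlam hg hM hM0 hε hC
  -- bounds near `0` of the two energy integrands
  obtain ⟨Bu, hBu⟩ := eventually_abs_greenSolI_le hlam hM hM0 hA
  obtain ⟨Bu', hBu'⟩ := eventually_abs_greenSolI'_le_all hlam hg hM hM0 hε hC
  have hF1 : ∀ᶠ t in 𝓝[>] (0 : ℝ), |Real.sinh (2 * t) * u t ^ 2| ≤ Real.sinh 2 * |Bu| ^ 2 := by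
    filter_upwards [hBu, Ioo_mem_nhdsGT one_pos] with t hBt ht
    have hsinh : 0 ≤ Real.sinh (2 * t) := Real.sinh_nonneg_iff.mpr (by linarith [ht.1])
    rw [abs_mul, abs_of_nonneg hsinh, abs_pow]
    exact mul_le_mul (Real.sinh_le_sinh.mpr (by linarith [ht.2]))
      (pow_le_pow_left₀ (abs_nonneg _) (le_trans hBt (le_abs_self _)) 2) (by positivity)
      (Real.sinh_pos_iff.mpr two_pos).le
  have hF2 : ∀ᶠ t in 𝓝[>] (0 : ℝ), |Real.sinh (2 * t) * u' t ^ 2| ≤ Real.sinh 2 * |Bu'| ^ 2 := by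
    filter_upwards [hBu', Ioo_mem_nhdsGT one_pos] with t hBt ht
    have hsinh : 0 ≤ Real.sinh (2 * t) := Real.sinh_nonneg_iff.mpr (by linarith [ht.1])
    rw [abs_mul, abs_of_nonneg hsinh, abs_pow]
    exact mul_le_mul (Real.sinh_le_sinh.mpr (by linarith [ht.2]))
      (pow_le_pow_left₀ (abs_nonneg _) (le_trans hBt (le_abs_self _)) 2) (by positivity)
      (Real.sinh_pos_iff.mpr two_pos).le
  -- `∫_0^R r = ∫_0^R sinh u′² − ∫_0^R sinh u² − H(R)` for `R ≥ 1` (the limit `ε₀ → 0⁺`)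
  have hfin : ∀ R, 1 ≤ R → ∫ t in (0 : ℝ)..R, r t
      = (∫ t in (0 : ℝ)..R, Real.sinh (2 * t) * u' t ^ 2) - (∫ t in (0 : ℝ)..R, Real.sinh (2 * t) * u t ^ 2)
        - hardyBracket u R := by
    intro R hR
    have hR0 : 0 < R := lt_of_lt_of_le one_pos hR
    have hl0 := tendsto_intervalIntegral_nhdsGT_zero hR0 (hIoc R) hB
    have hl1 := tendsto_intervalIntegral_nhdsGT_zero hR0 (hI1.mono_set Set.Ioc_subset_Ioi_self) hF1
    have hl2 := tendsto_intervalIntegral_nhdsGT_zero hR0 (hI2.mono_set Set.Ioc_subset_Ioi_self) hF2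
    have hH := tendsto_hardyBracket_greenSolI_nhdsGT_zero hlam hg hM hM0 hε hC
    have hr : Tendsto (fun ε₀ => (∫ t in ε₀..R, Real.sinh (2 * t) * u' t ^ 2)
        - (∫ t in ε₀..R, Real.sinh (2 * t) * u t ^ 2) - (hardyBracket u R - hardyBracket u ε₀))
        (𝓝[>] (0 : ℝ)) (𝓝 ((∫ t in (0 : ℝ)..R, Real.sinh (2 * t) * u' t ^ 2)
          - (∫ t in (0 : ℝ)..R, Real.sinh (2 * t) * u t ^ 2) - (hardyBracket u R - 0))) :=
      (hl2.sub hl1).sub (tendsto_const_nhds.sub hH)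
    rw [sub_zero] at hr
    refine tendsto_nhds_unique hl0 (hr.congr' ?_)
    filter_upwards [Ioo_mem_nhdsGT hR0] with ε₀ hε₀
    exact (remainder_identity_interval_class hlam hg hM hM0 hε hC hε₀.1 hε₀.2.le).symm
  -- `R → ∞`
  have hR0 : Tendsto (fun R => ∫ t in (0 : ℝ)..R, r t) atTop (𝓝 (∫ t in Ioi 0, r t)) :=
    intervalIntegral_tendsto_integral_Ioi 0 hIr tendsto_id
  have hR2 : Tendsto (fun R => (∫ t in (0 : ℝ)..R, Real.sinh (2 * t) * u' t ^ 2)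
      - (∫ t in (0 : ℝ)..R, Real.sinh (2 * t) * u t ^ 2) - hardyBracket u R) atTop
      (𝓝 ((∫ t in Ioi 0, Real.sinh (2 * t) * u' t ^ 2) - (∫ t in Ioi 0, Real.sinh (2 * t) * u t ^ 2) - 0)) :=
    ((intervalIntegral_tendsto_integral_Ioi 0 hI2 tendsto_id).sub
      (intervalIntegral_tendsto_integral_Ioi 0 hI1 tendsto_id)).sub
      (tendsto_hardyBracket_greenSolI_atTop hlam hg hM hM0 hε hC hε1)
  rw [sub_zero] at hR2
  refine tendsto_nhds_unique hR0 (hR2.congr' ?_)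
  filter_upwards [eventually_ge_atTop 1] with R hR
  exact (hfin R hR).symm

end measure

end Summit.Ventures.HodgeRepro2.T5SU11ImproperHardyRemainderClass
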